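import Mathlib
import Literature.Probability.LatticeModels.ConformalCovariance
import HarnessLib

/-!
# Dilations are words in translations and special conformal maps: `stub_scaleOfSCT`

(Registered stub `stub_scaleOfSCT` of line `multipole-ward-nonsat-endpoint` for the crux
`PrecisionLaplacian.MoebiusLimitOfTwoPointLaw`, item stmt-CriticalPhenomena-4801.)

Let `S : CorrFamily 3` be translation invariant and covariant, with weight
`∏ᵢ σ_a(xᵢ) ^ Δ`, `σ_a(x) = 1 + 2⟪a, x⟫ + ‖a‖²‖x‖²`, under the finite special conformal maps
`SCT_a x = σ_a(x)⁻¹ • (x + ‖x‖² • a)` at configurations off the origin whose SCT path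
`s ↦ SCT_{sa}`, `s ∈ [0, 1]`, meets no pole. Then `S` is scale covariant with weight `Δ`
(`IsScaleCovariant Δ S`).

Proof. For `λ > 0` and a unit vector `b` the dilation `x ↦ λ² x` is the word
`τ_{λb} ∘ SCT_{−b/λ} ∘ τ_{(λ−1)b} ∘ SCT_b ∘ τ_{−b}` (on every plane through the axis `ℝb` this is
the `PSL₂(ℝ)` identity `E₁₂(λ)E₂₁(−1/λ)E₁₂(λ−1)E₂₁(1)E₁₂(−1) = diag(λ, 1/λ)`). Orbit of a point
`x ∉ ℝb`: `x − b`, `b + R_b(x)/‖x‖²` (weight `‖x‖²`), `λb + R_b(x)/‖x‖²`, `λ²x − λb` (weight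
`1/(λ²‖x‖²)`), `λ²x`, where `R_b x = x − 2⟪b, x⟫b`; both SCT paths are pole free as soon as
`x ∉ ℝb`, and the two weights multiply to `(λ²)⁻¹` per point. An arbitrary configuration is
first translated off the axis `ℝb` (translation invariance on both sides).

References: P. Di Francesco, P. Mathieu, D. Sénéchal, *Conformal Field Theory* (Springer 1997),
§4.1 (special conformal transformations and dilations in the conformal group of `ℝ^d`).
-/

noncomputable section

open Literature.Probability.LatticeModels

namespace Summit.CriticalPhenomena.Ising3DConformalLimit.PrecisionLaplacianMoebiusLimitOfTwoPointLaw

/-! ### Pointwise algebra of the first special conformal map `SCT_b ∘ τ_{-b}` -/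

/-- A point off the line `ℝb` is not the origin. [folklore] -/
theorem sctD_ne_zero {b x : EuclideanSpace ℝ (Fin 3)} (hx : ∀ μ : ℝ, x ≠ μ • b) : x ≠ 0 :=
  fun h => hx 0 (by rw [zero_smul]; exact h)

/-- A point off the line `ℝb` is not the point `b`. [folklore] -/
theorem sctD_sub_ne_zero {b x : EuclideanSpace ℝ (Fin 3)} (hx : ∀ μ : ℝ, x ≠ μ • b) :
    x - b ≠ 0 :=
  fun h => hx 1 (by rw [one_smul]; exact sub_eq_zero.1 h)

/-- The path `s ↦ SCT_{sb} (x - b)`, `s ∈ [0, 1]`, has no pole when `x ∉ ℝb`. [folklore] -/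
theorem sctD_polefree_one {b x : EuclideanSpace ℝ (Fin 3)} (hb : ‖b‖ = 1)
    (hx : ∀ μ : ℝ, x ≠ μ • b) (s : ℝ) :
    1 + 2 * s * inner ℝ b (x - b) + s ^ 2 * ‖b‖ ^ 2 * ‖x - b‖ ^ 2 ≠ 0 := by
  -- key identity: the path weight is the square `‖(1 - s) • b + s • x‖²`
  have key : 1 + 2 * s * inner ℝ b (x - b) + s ^ 2 * ‖b‖ ^ 2 * ‖x - b‖ ^ 2 =
      ‖(1 - s) • b + s • x‖ ^ 2 := by
    simp only [norm_add_sq_real, norm_sub_sq_real, norm_smul, inner_sub_right, real_inner_smul_left,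
      real_inner_smul_right, real_inner_self_eq_norm_sq, hb, real_inner_comm b x, Real.norm_eq_abs,
      mul_pow, sq_abs, one_pow, mul_one]
    ring
  rw [key, ne_eq, sq_eq_zero_iff, norm_eq_zero]
  intro h
  rcases eq_or_ne s 0 with rfl | hs0
  · have h0 : b = 0 := by simpa using h
    rw [h0, norm_zero] at hb
    exact zero_ne_one hb
  · refine hx (-(1 - s) / s) ?_
    calc x = x - s⁻¹ • ((1 - s) • b + s • x) := by rw [h, smul_zero, sub_zero]
      _ = (-(1 - s) / s) • b := by
        match_scalars <;> field_simp
        ring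

/-- `SCT_b (x - b) = b + R_b(x)/‖x‖²` with `R_b x = x - 2⟪b, x⟫ b` (`‖b‖ = 1`, `x ≠ 0`), the
weight `σ_b(x - b)` being already replaced by `‖x‖²`. [folklore] -/
theorem sctD_sct_one {b x : EuclideanSpace ℝ (Fin 3)} (hb : ‖b‖ = 1) (hx : x ≠ 0) :
    (‖x‖ ^ 2)⁻¹ • ((x - b) + ‖x - b‖ ^ 2 • b) =
      (‖x‖ ^ 2)⁻¹ • (x - (2 * inner ℝ b x) • b) + b := by
  have hn : ‖x‖ ≠ 0 := norm_ne_zero_iff.2 hx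
  rw [norm_sub_sq_real, hb, real_inner_comm b x]
  match_scalars <;> field_simp
  ring

/-! ### Pointwise algebra of the second special conformal map `SCT_{-b/λ} ∘ τ_{λ b}` -/

/-- `‖R_b(x)/‖x‖² + λ b‖² = 1/‖x‖² - 2λ⟪b, x⟫/‖x‖² + λ²` (`‖b‖ = 1`, `x ≠ 0`). [folklore] -/
theorem sctD_norm_y_sq {b x : EuclideanSpace ℝ (Fin 3)} (hb : ‖b‖ = 1) (hx : x ≠ 0) (l : ℝ) :
    ‖(‖x‖ ^ 2)⁻¹ • (x - (2 * inner ℝ b x) • b) + l • b‖ ^ 2 =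
      (‖x‖ ^ 2)⁻¹ - 2 * l * inner ℝ b x * (‖x‖ ^ 2)⁻¹ + l ^ 2 := by
  have hn : ‖x‖ ≠ 0 := norm_ne_zero_iff.2 hx
  simp only [norm_add_sq_real, norm_sub_sq_real, norm_smul, real_inner_smul_left,
    real_inner_smul_right, inner_sub_left, real_inner_self_eq_norm_sq, hb, real_inner_comm b x,
    Real.norm_eq_abs, mul_pow, sq_abs, one_pow, mul_one]
  field_simp
  ring

/-- The weight of `SCT_{-b/λ}` at `R_b(x)/‖x‖² + λ b` is `1/(λ²‖x‖²)` (`‖b‖ = 1`, `x ≠ 0`,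
`λ > 0`). [folklore] -/
theorem sctD_sigma_three {b x : EuclideanSpace ℝ (Fin 3)} (hb : ‖b‖ = 1) (hx : x ≠ 0) {l : ℝ}
    (hl : 0 < l) :
    1 + 2 * inner ℝ (-(l⁻¹ • b)) ((‖x‖ ^ 2)⁻¹ • (x - (2 * inner ℝ b x) • b) + l • b) +
        ‖-(l⁻¹ • b)‖ ^ 2 * ‖(‖x‖ ^ 2)⁻¹ • (x - (2 * inner ℝ b x) • b) + l • b‖ ^ 2 =
      (l ^ 2 * ‖x‖ ^ 2)⁻¹ := by
  have hn : ‖x‖ ≠ 0 := norm_ne_zero_iff.2 hx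
  have hl' : l ≠ 0 := hl.ne'
  rw [sctD_norm_y_sq hb hx l]
  simp only [inner_neg_left, real_inner_smul_left, inner_add_right, real_inner_smul_right,
    inner_sub_right, real_inner_self_eq_norm_sq, hb, norm_neg, norm_smul, Real.norm_eq_abs,
    sq_abs, one_pow, mul_one]
  field_simp
  ring

/-- `SCT_{-b/λ} (R_b(x)/‖x‖² + λ b) = λ² x - λ b` (`‖b‖ = 1`, `x ≠ 0`, `λ > 0`), the weight
being already replaced by `1/(λ²‖x‖²)`. [folklore] -/
theorem sctD_sct_three {b x : EuclideanSpace ℝ (Fin 3)} (hb : ‖b‖ = 1) (hx : x ≠ 0) {l : ℝ}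
    (hl : 0 < l) :
    ((l ^ 2 * ‖x‖ ^ 2)⁻¹)⁻¹ • (((‖x‖ ^ 2)⁻¹ • (x - (2 * inner ℝ b x) • b) + l • b) +
        ‖(‖x‖ ^ 2)⁻¹ • (x - (2 * inner ℝ b x) • b) + l • b‖ ^ 2 • (-(l⁻¹ • b))) =
      l ^ 2 • x - l • b := by
  have hn : ‖x‖ ≠ 0 := norm_ne_zero_iff.2 hx
  have hl' : l ≠ 0 := hl.ne'
  rw [inv_inv, sctD_norm_y_sq hb hx l]
  match_scalars <;> field_simp
  ring

/-- Key identity for the path `s ↦ SCT_{-sb/λ}` at a point `y` (`‖b‖ = 1`, `λ > 0`):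
`σ_{-sb/λ}(y) = ‖(s/λ) • y - b‖²`. [folklore] -/
theorem sctD_keyid_three {b : EuclideanSpace ℝ (Fin 3)} (hb : ‖b‖ = 1) {l : ℝ} (hl : 0 < l)
    (s : ℝ) (y : EuclideanSpace ℝ (Fin 3)) :
    1 + 2 * s * inner ℝ (-(l⁻¹ • b)) y + s ^ 2 * ‖-(l⁻¹ • b)‖ ^ 2 * ‖y‖ ^ 2 =
      ‖(s * l⁻¹) • y - b‖ ^ 2 := by
  have hl' : l ≠ 0 := hl.ne'
  simp only [norm_sub_sq_real, inner_neg_left, real_inner_smul_left, norm_neg, norm_smul, hb,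
    real_inner_comm b y, Real.norm_eq_abs, mul_pow, sq_abs, mul_one, one_pow]
  ring

/-- The path `s ↦ SCT_{-sb/λ} (R_b(x)/‖x‖² + λ b)`, `s ∈ [0, 1]`, has no pole when `x ∉ ℝb`.
[folklore] -/
theorem sctD_polefree_three {b x : EuclideanSpace ℝ (Fin 3)} (hb : ‖b‖ = 1)
    (hx : ∀ μ : ℝ, x ≠ μ • b) {l : ℝ} (hl : 0 < l) (s : ℝ) :
    1 + 2 * s * inner ℝ (-(l⁻¹ • b)) ((‖x‖ ^ 2)⁻¹ • (x - (2 * inner ℝ b x) • b) + l • b) +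
        s ^ 2 * ‖-(l⁻¹ • b)‖ ^ 2 * ‖(‖x‖ ^ 2)⁻¹ • (x - (2 * inner ℝ b x) • b) + l • b‖ ^ 2 ≠
      0 := by
  have hn : ‖x‖ ≠ 0 := norm_ne_zero_iff.2 (sctD_ne_zero hx)
  have hl' : l ≠ 0 := hl.ne'
  rw [sctD_keyid_three hb hl, ne_eq, sq_eq_zero_iff, norm_eq_zero, sub_eq_zero]
  intro h
  rcases eq_or_ne s 0 with rfl | hs0
  · rw [zero_mul, zero_smul] at h
    rw [← h, norm_zero] at hb
    exact zero_ne_one hb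
  · refine hx (l * ‖x‖ ^ 2 / s + 2 * inner ℝ b x - l * ‖x‖ ^ 2) ?_
    calc x = x + (l * ‖x‖ ^ 2 / s) •
          (b - (s * l⁻¹) • ((‖x‖ ^ 2)⁻¹ • (x - (2 * inner ℝ b x) • b) + l • b)) := by
            rw [h, sub_self, smul_zero, add_zero]
      _ = (l * ‖x‖ ^ 2 / s + 2 * inner ℝ b x - l * ‖x‖ ^ 2) • b := by
            match_scalars <;> field_simp <;> ring

/-- The point `R_b(x)/‖x‖² + λ b` is not the origin when `x ∉ ℝb`. [folklore] -/
theorem sctD_y_ne_zero {b x : EuclideanSpace ℝ (Fin 3)} (hx : ∀ μ : ℝ, x ≠ μ • b) (l : ℝ) :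
    (‖x‖ ^ 2)⁻¹ • (x - (2 * inner ℝ b x) • b) + l • b ≠ 0 := by
  have hn : ‖x‖ ≠ 0 := norm_ne_zero_iff.2 (sctD_ne_zero hx)
  intro h
  refine hx (2 * inner ℝ b x - l * ‖x‖ ^ 2) ?_
  calc x = x - (‖x‖ ^ 2) • ((‖x‖ ^ 2)⁻¹ • (x - (2 * inner ℝ b x) • b) + l • b) := by
          rw [h, smul_zero, sub_zero]
    _ = (2 * inner ℝ b x - l * ‖x‖ ^ 2) • b := by match_scalars <;> field_simp <;> ring

/-! ### The word `τ_{λb} ∘ SCT_{−b/λ} ∘ τ_{(λ−1)b} ∘ SCT_b ∘ τ_{−b}` is the dilation by `λ²` -/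

/-- Core of `stub_scaleOfSCT`: for a translation-invariant family covariant under the pole-free
special conformal maps, a unit vector `b`, `λ > 0` and a configuration off the axis `ℝb`,
`S n (λ² x) = (λ²)^{-nΔ} S n x`, by running the word
`τ_{λb} ∘ SCT_{−b/λ} ∘ τ_{(λ−1)b} ∘ SCT_b ∘ τ_{−b}` through the configuration. [folklore] -/
theorem sctD_core {S : CorrFamily 3} {Δ : ℝ} (htr : IsTranslationInvariant S)
    (hSCT : ∀ (n : ℕ) (a : EuclideanSpace ℝ (Fin 3)) (x : Fin n → EuclideanSpace ℝ (Fin 3)),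
      (∀ i, x i ≠ 0) →
      (∀ i, ∀ s ∈ Set.Icc (0 : ℝ) 1,
        1 + 2 * s * inner ℝ a (x i) + s ^ 2 * ‖a‖ ^ 2 * ‖x i‖ ^ 2 ≠ 0) →
      S n (fun i => (1 + 2 * inner ℝ a (x i) + ‖a‖ ^ 2 * ‖x i‖ ^ 2)⁻¹ • (x i + ‖x i‖ ^ 2 • a)) =
        (∏ i, (1 + 2 * inner ℝ a (x i) + ‖a‖ ^ 2 * ‖x i‖ ^ 2) ^ Δ) * S n x)
    {b : EuclideanSpace ℝ (Fin 3)} (hb : ‖b‖ = 1) {l : ℝ} (hl : 0 < l) {n : ℕ}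
    {x : Fin n → EuclideanSpace ℝ (Fin 3)} (hx : ∀ i (μ : ℝ), x i ≠ μ • b) :
    S n (fun i => l ^ 2 • x i) = (l ^ 2) ^ (-(n : ℝ) * Δ) * S n x := by
  have hx0 : ∀ i, x i ≠ 0 := fun i => sctD_ne_zero (hx i)
  -- `τ_{-b}`
  have h1 : S n (fun i => x i - b) = S n x := by
    simpa only [sub_eq_add_neg] using htr n (-b) x
  -- `SCT_b`
  have h2 : S n (fun i => (‖x i‖ ^ 2)⁻¹ • (x i - (2 * inner ℝ b (x i)) • b) + b) =
      (∏ i, (‖x i‖ ^ 2) ^ Δ) * S n (fun i => x i - b) := by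
    have h := hSCT n b (fun i => x i - b) (fun i => sctD_sub_ne_zero (hx i))
      (fun i s _ => sctD_polefree_one hb (hx i) s)
    -- the weight `σ_b(y - b) = ‖y‖²`
    have hσ : ∀ y : EuclideanSpace ℝ (Fin 3),
        1 + 2 * inner ℝ b (y - b) + ‖b‖ ^ 2 * ‖y - b‖ ^ 2 = ‖y‖ ^ 2 := fun y => by
      simp only [norm_sub_sq_real, inner_sub_right, real_inner_self_eq_norm_sq, hb,
        real_inner_comm b y, one_pow, one_mul]
      ring
    simp only [hσ] at h
    simp only [sctD_sct_one hb (hx0 _)] at h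
    exact h
  -- `τ_{(λ-1)b}`
  have h3 : S n (fun i => (‖x i‖ ^ 2)⁻¹ • (x i - (2 * inner ℝ b (x i)) • b) + l • b) =
      S n (fun i => (‖x i‖ ^ 2)⁻¹ • (x i - (2 * inner ℝ b (x i)) • b) + b) := by
    have h := htr n ((l - 1) • b) (fun i => (‖x i‖ ^ 2)⁻¹ • (x i - (2 * inner ℝ b (x i)) • b) + b)
    refine Eq.trans ?_ h
    congr 1
    funext i
    module
  -- `SCT_{-b/λ}`
  have h4 : S n (fun i => l ^ 2 • x i - l • b) = (∏ i, ((l ^ 2 * ‖x i‖ ^ 2)⁻¹) ^ Δ) *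
      S n (fun i => (‖x i‖ ^ 2)⁻¹ • (x i - (2 * inner ℝ b (x i)) • b) + l • b) := by
    have h := hSCT n (-(l⁻¹ • b))
      (fun i => (‖x i‖ ^ 2)⁻¹ • (x i - (2 * inner ℝ b (x i)) • b) + l • b)
      (fun i => sctD_y_ne_zero (hx i) l) (fun i s _ => sctD_polefree_three hb (hx i) hl s)
    simp only [sctD_sigma_three hb (hx0 _) hl] at h
    simp only [sctD_sct_three hb (hx0 _) hl] at h
    exact h
  -- `τ_{λb}`
  have h5 : S n (fun i => l ^ 2 • x i) = S n (fun i => l ^ 2 • x i - l • b) := by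
    simpa only [sub_add_cancel] using htr n (l • b) (fun i => l ^ 2 • x i - l • b)
  -- the weights
  have hw : ∀ i, ((l ^ 2 * ‖x i‖ ^ 2)⁻¹) ^ Δ * (‖x i‖ ^ 2) ^ Δ = (l ^ 2) ^ (-Δ) := by
    intro i
    have hr : ‖x i‖ ^ 2 ≠ 0 := pow_ne_zero _ (norm_ne_zero_iff.2 (hx0 i))
    rw [← Real.mul_rpow (inv_nonneg.2 (by positivity)) (by positivity), mul_inv,
      inv_mul_cancel_right₀ hr, Real.inv_rpow (by positivity), Real.rpow_neg (by positivity)]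
  rw [h5, h4, h3, h2, h1, ← mul_assoc, ← Finset.prod_mul_distrib]
  simp only [hw]
  rw [Finset.prod_const, Finset.card_univ, Fintype.card_fin, ← Real.rpow_natCast,
    ← Real.rpow_mul (by positivity), show -Δ * (n : ℝ) = -(n : ℝ) * Δ by ring]

/-! ### The registered stub -/

/-- **Stub G1 (`stub_scaleOfSCT`) — dilations are words in translations and SCTs.** A
translation-invariant correlation family on `ℝ³` which is covariant, with weight
`∏ᵢ (1 + 2⟪a, xᵢ⟫ + ‖a‖²‖xᵢ‖²) ^ Δ`, under the finite special conformal maps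
`x ↦ (x + ‖x‖² a)/(1 + 2⟪a, x⟫ + ‖a‖²‖x‖²)` at configurations off the origin with pole-free SCT
path, is scale covariant with weight `Δ`: for `λ > 0` and a unit vector `b`,
`D_{λ²} = τ_{λb} ∘ SCT_{−b/λ} ∘ τ_{(λ−1)b} ∘ SCT_b ∘ τ_{−b}`, all poles lying on the axis `ℝb`,
which a preliminary translation avoids. (The support hypothesis is not used.) [folklore] -/
theorem stub_scaleOfSCT :
    ∀ (S : CorrFamily 3) (Δ : ℝ), (∀ n z, z ∉ NonCoincident 3 n → S n z = 0) → IsTranslationInvariant S →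
      (∀ (n : ℕ) (a : EuclideanSpace ℝ (Fin 3)) (x : Fin n → EuclideanSpace ℝ (Fin 3)), (∀ i, x i ≠ 0) →
        (∀ i, ∀ s ∈ Set.Icc (0 : ℝ) 1, 1 + 2 * s * inner ℝ a (x i) + s ^ 2 * ‖a‖ ^ 2 * ‖x i‖ ^ 2 ≠ 0) →
        S n (fun i => (1 + 2 * inner ℝ a (x i) + ‖a‖ ^ 2 * ‖x i‖ ^ 2)⁻¹ • (x i + ‖x i‖ ^ 2 • a)) =
          (∏ i, (1 + 2 * inner ℝ a (x i) + ‖a‖ ^ 2 * ‖x i‖ ^ 2) ^ Δ) * S n x) →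
      IsScaleCovariant Δ S := by
  intro S Δ _ htr hSCT n c hc x
  obtain ⟨l, hl, rfl⟩ : ∃ l : ℝ, 0 < l ∧ l ^ 2 = c :=
    ⟨Real.sqrt c, Real.sqrt_pos.2 hc, Real.sq_sqrt hc.le⟩
  -- an orthonormal pair: the axis `b` and a direction `d ⊥ b` along which to translate
  obtain ⟨b, d, hb, hbd, hdd⟩ : ∃ b d : EuclideanSpace ℝ (Fin 3),
      ‖b‖ = 1 ∧ inner ℝ b d = 0 ∧ inner ℝ d d = 1 :=
    ⟨EuclideanSpace.single 0 1, EuclideanSpace.single 1 1, by simp,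
      by simp [EuclideanSpace.inner_single_left], by simp⟩
  -- translate the configuration off the axis `ℝb`
  obtain ⟨t, ht⟩ : ∃ t : ℝ, ∀ i, 0 < inner ℝ (x i) d + t := by
    refine ⟨1 + ∑ j, |inner ℝ (x j) d|, fun i => ?_⟩
    have h1 : |inner ℝ (x i) d| ≤ ∑ j, |inner ℝ (x j) d| :=
      Finset.single_le_sum (f := fun j => |inner ℝ (x j) d|) (fun j _ => abs_nonneg _)
        (Finset.mem_univ i)
    have h2 := neg_abs_le (inner ℝ (x i) d)
    linarith
  have hline : ∀ i (μ : ℝ), x i + t • d ≠ μ • b := by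
    intro i μ h
    have h' := congrArg (fun z => inner ℝ z d) h
    simp only [inner_add_left, real_inner_smul_left, hbd, hdd, mul_one, mul_zero] at h'
    linarith [ht i]
  calc S n (fun i => l ^ 2 • x i)
      = S n (fun i => l ^ 2 • x i + l ^ 2 • (t • d)) :=
        (htr n (l ^ 2 • (t • d)) (fun i => l ^ 2 • x i)).symm
    _ = S n (fun i => l ^ 2 • (x i + t • d)) := by simp only [smul_add]
    _ = (l ^ 2) ^ (-(n : ℝ) * Δ) * S n (fun i => x i + t • d) := sctD_core htr hSCT hb hl hline
    _ = (l ^ 2) ^ (-(n : ℝ) * Δ) * S n x := by rw [htr n (t • d) x]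

end Summit.CriticalPhenomena.Ising3DConformalLimit.PrecisionLaplacianMoebiusLimitOfTwoPointLaw

end
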